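import Summits.Ventures.GridStability.Models.WSCC9SPSaddlesUnstable
import Literature.MathematicalPhysics.PowerSystems.StructurePreservingNormalOperationStability
import HarnessLib

/-!
# GridStability/Models/WSCC9SPOneStable (statements + proofs by gridfusion-lit-1 g12, template 662707af96fe736c; filed UNCHANGED but for this
# header by gridfusion-model-7 g7 per lead g10 RULING 9ds (2), 2026-08-28):
# «ONE IS STABLE AND 255 ARE UNSTABLE» for the WSCC9-SP9 post-fault-B record, for EVERY damping vector
# `D > 0` — Manik–Timme–Witthaut 2017 Cor. 2, BOTH clauses, for the structure-preserving motions

Ingredients (all on tree): `Models/WSCC9SP.lean` (record, `δ₀`, `parentV`, `depthV`, `b_symm`, `window`,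
`theta_bounds`, `isSyncEquilibrium`), `Models/WSCC9SPPointConvergence.lean` (`depthV_parentV`,
`b_support`, `b_parentV_ne_zero`, `b_parentV_pos`, `M_nonneg`, `edgeFlow_lt`),
`Models/WSCC9SPSaddlesUnstable.lean` (★ #154: `parentV_root`, `δ₀_root`, `δ₀_mem_Ico`, `δ₀_sync`,
`ncard_unstable_syncStates`), lit-1 `Literature/…/StructurePreservingNormalOperationStability.lean`
(p588700: `BergenHill.syncSolution_locally_expStable_of_cohesive_of_tree`,
`BergenHill.one_stable_and_ncard_unstable_syncStates_of_tree`) over lit-2's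
`StructurePreservingSyncExponentialStability.lean` (spectral route) and lit-1's
`StructurePreservingNonMinimumInstability.lean` (energy route).
[cite: ManikTimmeWitthaut2017, §5.2 Cor. 2 and §3 Cor. 1 / Lemma 1; DorflerChertkovBullo2013, SI §3.1 Lemma 1 (ii), Lemma 2 (2), §3.2 Thm 2 (G1); Padiyar2013, §3.2 eqs (3.2)–(3.5)].
THREE COLUMNS: CERTIFIED for MODEL MV-3 record WSCC9-SP9 post-B (tokens of `WSCC9SP.lean`), every
`D > 0`: the record's cohesive synchronous state `δ₀` is a LOCALLY EXPONENTIALLY STABLE synchronous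
solution of the structure-preserving model modulo the uniform rotation (∃ ρ, k, λ > 0: every forward
solution with `‖(δ(0) − δ₀, v_G(0) − ω₀𝟙)‖ < ρ` has `‖(δ(t) − ω₀t𝟙 − (δ₀ + c𝟙), v_G(t) − ω₀𝟙)‖ ≤ k‖…(0)‖e^{−λt}`,
`ω₀ = 0` here), and the other 255 pinned synchronous states of the period box are UNSTABLE synchronous
solutions (★ #154); VALIDATED nothing numerical (ρ, k, λ existential); MODELLED as the record —
«stable»/«unstable» = synchronous solutions of MODEL M, never the WSCC system.
-/

noncomputable section

open Real Set Filter Topology Finset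

namespace Summit.Ventures.GridStability.Models.WSCC9SP

open StructurePreserving StructurePreserving.Params
open Literature.MathematicalPhysics.PowerSystems
open Literature.MathematicalPhysics.PowerSystems.ClassicalModel

/-- `δ₀` is STRICTLY phase-cohesive on the tree: every branch angle is `≤ θ < π/2`, so every
tree-line cosine is positive. -/
theorem δ₀_cohesive_strict : ∀ i : Fin 9, i ≠ 6 → 0 < Real.cos (δ₀ i - δ₀ (parentV i)) := by
  intro i hi
  have hw : |δ₀ i - δ₀ (parentV i)| ≤ θ :=
    window (fun _ => 1) i (parentV i) (by rw [params_b]; exact (b_parentV_ne_zero i hi))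
  have hθ := theta_bounds
  refine Real.cos_pos_of_mem_Ioo ⟨?_, ?_⟩
  · linarith [(abs_le.mp hw).1]
  · linarith [(abs_le.mp hw).2]

/-- ★ **THE RECORD'S COHESIVE SYNCHRONOUS STATE `δ₀` IS A LOCALLY EXPONENTIALLY STABLE SYNCHRONOUS
SOLUTION, FOR EVERY `D > 0`** (MODEL MV-3, record WSCC9-SP9 post-B; modulo the uniform rotation):
`∃ ρ, k, λ > 0` such that every forward solution `(δ, v)` of the Bergen–Hill equations with
`‖(δ(0) − δ₀, v_G(0) − ω₀𝟙)‖ < ρ` satisfies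
`‖(δ(t) − ω₀t𝟙 − (δ₀ + c𝟙), v_G(t) − ω₀𝟙)‖ ≤ k‖(δ(0) − (δ₀ + c𝟙), v_G(0) − ω₀𝟙)‖e^{−λt}` for `t ≥ 0`,
`c = (Σ Dᵢ(δᵢ(0) − δ₀ᵢ) + Σ_{gen} Mᵢ(vᵢ(0) − ω₀))/Σ Dᵢ`, `ω₀ = syncFrequency` (`= 0` here)
(`BergenHill.syncSolution_locally_expStable_of_cohesive_of_tree`, hypothesis-free on the radial record). -/
theorem δ₀_syncSolution_locally_expStable {D : Fin 9 → ℝ} (hD : ∀ i, 0 < D i) :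
    ∃ ρ > 0, ∃ k > 0, ∃ lam > 0, ∀ δ v : ℝ → Fin 9 → ℝ,
      (∀ t, 0 ≤ t → (params D).toBergenHill.IsSolutionAt δ v t) →
      ‖(params D).toBergenHill.phase (δ 0 - δ₀)
          (fun g => v 0 g.1 - (params D).toBergenHill.syncFrequency)‖ < ρ →
      ∀ t : ℝ, 0 ≤ t →
        ‖(params D).toBergenHill.phase (fun i => δ t i - (params D).toBergenHill.syncFrequency * t
              - (δ₀ i + (∑ j, (params D).toBergenHill.D j * (δ 0 j - δ₀ j)
                  + ∑ g : (params D).toBergenHill.Gen, (params D).toBergenHill.M g.1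
                      * (v 0 g.1 - (params D).toBergenHill.syncFrequency))
                    / ∑ j, (params D).toBergenHill.D j))
            (fun g => v t g.1 - (params D).toBergenHill.syncFrequency)‖
          ≤ k * ‖(params D).toBergenHill.phase (fun i => δ 0 i
              - (δ₀ i + (∑ j, (params D).toBergenHill.D j * (δ 0 j - δ₀ j)
                  + ∑ g : (params D).toBergenHill.Gen, (params D).toBergenHill.M g.1
                      * (v 0 g.1 - (params D).toBergenHill.syncFrequency))
                    / ∑ j, (params D).toBergenHill.D j))
            (fun g => v 0 g.1 - (params D).toBergenHill.syncFrequency)‖ * Real.exp (-lam * t) :=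
  BergenHill.syncSolution_locally_expStable_of_cohesive_of_tree (S := (params D).toBergenHill)
    (M_nonneg D) hD (fun i j => b_symm i j) depthV_parentV b_support b_parentV_pos (δ₀_sync D)
    δ₀_cohesive_strict

/-- ★★ **«ONE IS STABLE AND 255 ARE UNSTABLE», FOR EVERY `D > 0`** (MODEL MV-3, record WSCC9-SP9
post-B): (i) the pinned synchronous states of the half-open period box `[−π, π)⁹` other than the
record's cohesive `δ₀` number EXACTLY 255 and EVERY ONE of them is an unstable synchronous solution
(★ #154's clause, `BergenHill.ncard_unstable_syncStates_of_tree`, energy route); (ii) `δ₀` is a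
locally exponentially STABLE synchronous solution (`δ₀_syncSolution_locally_expStable`, spectral
route) — Manik–Timme–Witthaut's Cor. 2 «of the 2^{N−1} fixed points … one is stable and 2^{N−1} − 1
are unstable», both clauses, for the structure-preserving motions of the record
(`BergenHill.one_stable_and_ncard_unstable_syncStates_of_tree`). -/
theorem one_stable_and_ncard_unstable_syncStates {D : Fin 9 → ℝ} (hD : ∀ i, 0 < D i) :
    ({δ : Fin 9 → ℝ | δ 6 = 0 ∧ (∀ i, δ i ∈ Set.Ico (-π) π) ∧
        ∀ k, (params D).toBergenHill.flow δ k = (params D).toBergenHill.shiftedInjection k}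
        \ {δ₀}).ncard = 255 ∧
      (∀ θe ∈ {δ : Fin 9 → ℝ | δ 6 = 0 ∧ (∀ i, δ i ∈ Set.Ico (-π) π) ∧
          ∀ k, (params D).toBergenHill.flow δ k = (params D).toBergenHill.shiftedInjection k} \ {δ₀},
        ∃ ε > 0, ∀ r > 0, ∃ θ₁ : Fin 9 → ℝ, dist θ₁ θe < r ∧
          ∑ k, (params D).toBergenHill.D k * θ₁ k = ∑ k, (params D).toBergenHill.D k * θe k ∧
          ∀ δ v : ℝ → Fin 9 → ℝ, δ 0 = θ₁ →
            (∀ k, (params D).toBergenHill.M k ≠ 0 → v 0 k = (params D).toBergenHill.syncFrequency) →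
            (∀ t, 0 ≤ t → (params D).toBergenHill.IsSolutionAt δ v t) →
            ∃ t, 0 ≤ t ∧ ε < dist ((δ t, v t) : (Fin 9 → ℝ) × (Fin 9 → ℝ))
              ((fun k => θe k + (params D).toBergenHill.syncFrequency * t),
                fun _ => (params D).toBergenHill.syncFrequency)) ∧
      ∃ ρ > 0, ∃ k > 0, ∃ lam > 0, ∀ δ v : ℝ → Fin 9 → ℝ,
        (∀ t, 0 ≤ t → (params D).toBergenHill.IsSolutionAt δ v t) →
        ‖(params D).toBergenHill.phase (δ 0 - δ₀)
            (fun g => v 0 g.1 - (params D).toBergenHill.syncFrequency)‖ < ρ →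
        ∀ t : ℝ, 0 ≤ t →
          ‖(params D).toBergenHill.phase (fun i => δ t i - (params D).toBergenHill.syncFrequency * t
                - (δ₀ i + (∑ j, (params D).toBergenHill.D j * (δ 0 j - δ₀ j)
                    + ∑ g : (params D).toBergenHill.Gen, (params D).toBergenHill.M g.1
                        * (v 0 g.1 - (params D).toBergenHill.syncFrequency))
                      / ∑ j, (params D).toBergenHill.D j))
              (fun g => v t g.1 - (params D).toBergenHill.syncFrequency)‖
            ≤ k * ‖(params D).toBergenHill.phase (fun i => δ 0 i
                - (δ₀ i + (∑ j, (params D).toBergenHill.D j * (δ 0 j - δ₀ j)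
                    + ∑ g : (params D).toBergenHill.Gen, (params D).toBergenHill.M g.1
                        * (v 0 g.1 - (params D).toBergenHill.syncFrequency))
                      / ∑ j, (params D).toBergenHill.D j))
              (fun g => v 0 g.1 - (params D).toBergenHill.syncFrequency)‖ * Real.exp (-lam * t) := by
  obtain ⟨h1, h2⟩ := ncard_unstable_syncStates hD
  exact ⟨h1, h2, δ₀_syncSolution_locally_expStable hD⟩

end Summit.Ventures.GridStability.Models.WSCC9SP

end
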